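import Mathlib
import Summits.Ventures.PercRepro2.LocRows
import Summits.Ventures.PercRepro2.SwRow
import Summits.Ventures.PercRepro2.SwOut
import Summits.Ventures.PercRepro2.SwAllRow
import Summits.Ventures.PercRepro2.SwOutAll
import Summits.Ventures.PercRepro2.SwOutArmFlip
import Summits.Ventures.PercRepro2.SwOutArmThm
import Summits.Ventures.PercRepro2.SwOutReducible
import Summits.Ventures.PercRepro2.SwOutJunctionH1Defs

/-!
# Pure junctions adjacent to `h`: the arm principle beyond `hnadj` (blind cell PercRepro2,
night-4 g28, 2026-08-28; proofs/NIGHT4-G28.md §1)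

Theorem A (g14, `rigidOK_of_junctionH1`) needs the junction `u` NOT adjacent to `h` (`hnadj`);
g27 §9 found that boundary to be the heaviest of the junction lane (the smallest unsettled
connected instance, `l–3, h–4, o–3, o–4, 3–4` with `(l, h, o) = (0, 1, 2)`, is a junction `4`
adjacent to `h` whose other neighbours `o, 3` lie in a component of `G[U ∖ {h, u}]` with no
neighbour of `h`).  THIS FILE: when every neighbour of the junction other than `h` lies in such a
PURE component, the edge `h–u` is harmless — `u` lies in the red cluster of `h` exactly when that
edge is red (`notMem_cluster_h_of_blue_hu`: the junction's SPHERE `{u} ∪ (the pure components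
of its neighbours)` is entered only through the edge `h–u`), so `u` is never a core (a unique
edge `h–u` has one colour), every `Q`-point of every class is core-free, and g10's ARM
PRINCIPLE `rigidOK_of_coreFree` gives the rigid inequality.  The statement is made for a SET
`J` of such junctions at once (`PureJunctions`: no edge between two junctions, each pure
component adjacent to one junction only), the single junction being `J = {u}`.

* `compJ ends U h J p` — the component of `p` in `G[U ∖ ({h} ∪ J)]` (`compU` for `J = {u}`);
* `PureJunctions ends U h J o` — the junction set with its hypotheses;
* **`notMem_cluster_h_of_blue_hu`** — the sphere lemma; **`coreFree_of_pureJunctions`**;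
* **`rigidOK_of_pureJunctions`**, `reducible_of_pureJunctions`, **`swAll_of_pureJunctions`**,
  **`sw_of_pureJunctions`** — the class theorem and rows 2′SW-ALL / (SW);
* `pureJunctions_singleton`, **`sw_of_pureJunction`** — the single junction `u` adjacent to `h`
  by one edge, every other neighbour in a pure component of `G[U ∖ {h, u}]`.
-/

namespace Summit.Ventures.PercRepro2

namespace LocRows

open Hull

variable {V : Type*} {E : Type*} [Fintype E] [DecidableEq E]

open scoped Classical

variable {ends : E → Sym2 V}

section Vocabulary

variable (ends) (U : Set V) (h : V) (J : Set V)

/-- The component of `p` in `G[U ∖ ({h} ∪ J)]`. -/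
noncomputable def compJ (p : V) : Set V :=
  cluster ends (fun e => decide (e ∈ within ends (U \ insert h J))) p

/-- The sphere of the junction `u`: `u` together with the components (in `G[U ∖ ({h} ∪ J)]`) of
its neighbours inside `U` other than `h` and the junctions. -/
def sphereJ (u : V) : Set V :=
  {u} ∪ {y | ∃ e x, ends e = s(u, x) ∧ x ∈ U ∧ x ≠ h ∧ x ∉ J ∧ y ∈ compJ ends U h J x}

/-- **Pure junctions adjacent to `h`**: a set `J` of vertices of `U ∖ {h, o}`, each joined to `h`
by at most one edge, no edge between two of them, every neighbour `x ∈ U` of a junction other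
than `h` and the junctions lying in a component of `G[U ∖ ({h} ∪ J)]` with no neighbour of `h`
and no neighbour among the other junctions; every other vertex of `U ∖ {h, o}` carries an
outside edge or no edge. -/
structure PureJunctions (o : V) : Prop where
  J_sub : ∀ u ∈ J, u ∈ U
  J_ne_h : ∀ u ∈ J, u ≠ h
  J_ne_o : ∀ u ∈ J, u ≠ o
  hu_unique : ∀ u ∈ J, ∀ e e', ends e = s(h, u) → ends e' = s(h, u) → e = e'
  no_JJ : ∀ u ∈ J, ∀ u' ∈ J, u ≠ u' → ∀ e, ends e ≠ s(u, u')
  pure : ∀ u ∈ J, ∀ e x, ends e = s(u, x) → x ∈ U → x ≠ h → x ∉ J →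
    ∀ q ∈ compJ ends U h J x,
      (∀ e', ends e' ≠ s(h, q)) ∧ ∀ u' ∈ J, u' ≠ u → ∀ e', ends e' ≠ s(u', q)
  hout : ∀ x ∈ U, x ≠ h → x ≠ o → x ∉ J →
    (∃ e y, ends e = s(x, y) ∧ y ∉ U) ∨ (∀ e, x ∉ ends e)

end Vocabulary

section Comp

variable {U : Set V} {h : V} {J : Set V}

omit [Fintype E] [DecidableEq E] in
/-- `compJ` for the single junction `u` is `compU`. -/
lemma compJ_singleton (u p : V) : compJ ends U h {u} p = compU ends U h u p := rfl

omit [Fintype E] [DecidableEq E] in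
/-- A component of `G[U ∖ ({h} ∪ J)]` lies in a set containing its root and closed under the
edges into `U ∖ ({h} ∪ J)`. -/
lemma compJ_subset {p : V} {S : Set V} (hpS : p ∈ S)
    (hS : ∀ e x y, ends e = s(x, y) → x ∈ S → y ∈ U \ insert h J → y ∈ S) :
    compJ ends U h J p ⊆ S := by
  intro v hv
  refine mem_of_conn_of_closed (ends := ends) (S := S) ?_ hpS hv
  intro a ha b hab
  obtain ⟨_, e, he, hends⟩ := openGraph_adj.1 hab
  have he' : e ∈ within ends (U \ insert h J) := by simpa using he
  obtain ⟨x, hx, y, hy, hxy⟩ := he'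
  rw [hends, Sym2.eq_iff] at hxy
  rcases hxy with ⟨_, h2⟩ | ⟨_, h2⟩
  · exact hS e a b hends ha (by rw [h2]; exact hy)
  · exact hS e a b hends ha (by rw [h2]; exact hx)

omit [Fintype E] [DecidableEq E] in
/-- A component of `G[U ∖ ({h} ∪ J)]` of a vertex of `U ∖ ({h} ∪ J)` lies in `U ∖ ({h} ∪ J)`. -/
lemma compJ_subset_sdiff {p : V} (hp : p ∈ U \ insert h J) :
    compJ ends U h J p ⊆ U \ insert h J :=
  compJ_subset hp fun _ _ _ _ _ hy => hy

omit [Fintype E] [DecidableEq E] in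
/-- A component of `G[U ∖ ({h} ∪ J)]` of a vertex of `U` other than `h` and the junctions avoids
`h` and the junctions. -/
lemma compJ_subset_sdiff' {x : V} (hxU : x ∈ U) (hxh : x ≠ h) (hxJ : x ∉ J) :
    compJ ends U h J x ⊆ U \ insert h J :=
  compJ_subset_sdiff ⟨hxU, by simp [hxh, hxJ]⟩

omit [Fintype E] [DecidableEq E] in
/-- A component of `G[U ∖ ({h} ∪ J)]` is closed under the edges into `U ∖ ({h} ∪ J)`. -/
lemma mem_compJ_of_edge {p x y : V} {e : E} (hx : x ∈ compJ ends U h J p)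
    (hxU : x ∈ U \ insert h J) (hy : y ∈ U \ insert h J) (hxy : ends e = s(x, y)) :
    y ∈ compJ ends U h J p := by
  refine mem_cluster_of_edge (ends := ends) hx (e := e) ?_ hxy
  simp only [decide_eq_true_eq]
  exact ⟨x, hxU, y, hy, hxy⟩

end Comp

section Sphere

variable {U : Set V} {h o : V} {J : Set V} (hJ : PureJunctions ends U h J o)
include hJ

omit [Fintype E] [DecidableEq E] in
/-- `h` is not in the sphere of a junction. -/
lemma PureJunctions.h_notMem_sphere {u : V} (hu : u ∈ J) : h ∉ sphereJ ends U h J u := by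
  rintro (hh | ⟨e, x, hex, hxU, hxh, hxJ, hh⟩)
  · exact hJ.J_ne_h u hu hh.symm
  · exact ((compJ_subset_sdiff' hxU hxh hxJ) hh).2 (by simp)

omit [Fintype E] [DecidableEq E] in
/-- **The sphere lemma**: at a configuration whose hull of `h` lies in `U` and whose edges `h–u`
are all blue, the junction `u` is not in the red cluster of `h` — the sphere of `u` is entered
only through the edge `h–u`. -/
theorem PureJunctions.notMem_cluster_h_of_blue_hu {ζ : Config E} (hcl : hull ends ζ h ⊆ U)
    {u : V} (hu : u ∈ J) (hblue : ∀ e, ends e = s(h, u) → ζ e = false) :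
    u ∉ cluster ends ζ h := by
  intro huT
  -- the red cluster of `h` avoids the sphere
  have key : cluster ends ζ h ⊆ {y | y ∈ cluster ends ζ h ∧ y ∉ sphereJ ends U h J u} := by
    intro y hy
    refine mem_of_conn_of_closed (ends := ends) (ω := ζ) ?_
      ⟨mem_cluster_self _ _ _, hJ.h_notMem_sphere hu⟩ hy
    rintro a ⟨haT, haS⟩ b hab
    have hbT : b ∈ cluster ends ζ h := mem_cluster_of_adj haT hab
    refine ⟨hbT, ?_⟩
    obtain ⟨_, e, he, hends⟩ := openGraph_adj.1 hab
    have haU : a ∈ U := hcl (Or.inl haT)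
    rintro (hb | ⟨e₁, x, hex, hxU, hxh, hxJ, hb⟩)
    · -- `b = u`: the edge `a–u` enters the sphere
      rw [Set.mem_singleton_iff] at hb
      subst hb
      by_cases hah : a = h
      · subst hah
        have := hblue e hends
        rw [he] at this
        exact Bool.noConfusion this
      by_cases haJ : a ∈ J
      · have hau : a ≠ b := fun hab' => haS (Or.inl hab')
        exact hJ.no_JJ a haJ b hu hau e hends
      · exact haS (Or.inr ⟨e, a, ends_swap hends, haU, hah, haJ,
          mem_cluster_self _ _ _⟩)
    · -- `b` in a pure component of the sphere
      by_cases hah : a = h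
      · subst hah
        exact (hJ.pure u hu e₁ x hex hxU hxh hxJ b hb).1 e hends
      by_cases haJ : a ∈ J
      · have hau : a ≠ u := fun hau => haS (Or.inl hau)
        exact (hJ.pure u hu e₁ x hex hxU hxh hxJ b hb).2 a haJ hau e hends
      · have haU' : a ∈ U \ insert h J := ⟨haU, by simp [hah, haJ]⟩
        have hbU' : b ∈ U \ insert h J := compJ_subset_sdiff' hxU hxh hxJ hb
        exact haS (Or.inr ⟨e₁, x, hex, hxU, hxh, hxJ,
          mem_compJ_of_edge hb hbU' haU' (ends_swap hends)⟩)
  exact (key huT).2 (Or.inl rfl)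

omit [Fintype E] [DecidableEq E] in
/-- At a configuration whose hull of `h` lies in `U`, a junction in the red cluster of `h` has a
red edge to `h`. -/
theorem PureJunctions.exists_red_hu {ζ : Config E} (hcl : hull ends ζ h ⊆ U) {u : V}
    (hu : u ∈ J) (huT : u ∈ cluster ends ζ h) : ∃ e, ends e = s(h, u) ∧ ζ e = true := by
  by_contra hne
  refine hJ.notMem_cluster_h_of_blue_hu hcl hu (fun e he => ?_) huT
  cases h' : ζ e
  · rfl
  · exact absurd ⟨e, he, h'⟩ hne

omit [Fintype E] [DecidableEq E] in
/-- A junction is never a core of `h` at a configuration whose hull of `h` lies in `U`. -/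
theorem PureJunctions.not_core {ζ : Config E} (hcl : hull ends ζ h ⊆ U) {u : V} (hu : u ∈ J)
    (huT : u ∈ cluster ends ζ h) (huT' : u ∈ cluster ends (blue ζ) h) : False := by
  obtain ⟨e, he, hred⟩ := hJ.exists_red_hu hcl hu huT
  have hcl' : hull ends (blue ζ) h ⊆ U := by rw [hull_blue]; exact hcl
  obtain ⟨e', he', hblue⟩ := hJ.exists_red_hu hcl' hu huT'
  have hee : e = e' := hJ.hu_unique u hu e e' he he'
  subst hee
  rw [blue_eq_true_iff] at hblue
  rw [hred] at hblue
  exact Bool.noConfusion hblue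

/-- **Every `Q`-point of every class is core-free**: a core carries no outside edge and is not
`o`, so it is a junction, which is never a core. -/
theorem PureJunctions.coreFree {l : V} {ξ ζ : Config E} (hζ : ζ ∈ swOutSide ends l h o U ξ) :
    CoreFree ends ζ h := by
  intro x hxT hxTp
  by_contra hxh
  have hQ := (mem_swOutSide.1 hζ).1
  have hcl := (mem_swOutSide.1 hζ).2
  simp only [tgtU, Finset.mem_filter, Finset.mem_univ, true_and, Set.mem_setOf_eq, hull,
    Set.mem_union, not_or] at hQ
  obtain ⟨⟨hhA, _⟩, hoA, _⟩ := hQ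
  have hxU : x ∈ U := (mem_outClass.1 hcl).2 (Or.inl hxT)
  by_cases hxo : x = o
  · subst hxo
    exact hhA (conn_trans hoA (conn_symm hxT))
  by_cases hxJ : x ∈ J
  · exact hJ.not_core (mem_outClass.1 hcl).2 hxJ hxT hxTp
  rcases hJ.hout x hxU hxh hxo hxJ with ⟨e, y, hxy, hyU⟩ | hiso
  · cases he : ζ e with
    | true => exact hyU ((mem_outClass.1 hcl).2 (Or.inl (mem_cluster_of_edge hxT he hxy)))
    | false =>
      have he' : blue ζ e = true := by rw [blue_eq_true_iff]; exact he
      exact hyU ((mem_outClass.1 hcl).2 (Or.inr (mem_cluster_of_edge hxTp he' hxy)))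
  · obtain ⟨e, hxe⟩ := exists_edge_of_mem_cluster hxT hxh
    exact hiso e hxe

/-- **The rigid inequality on every class of a region with pure junctions adjacent to `h`**
(no loop at `h`): the arm principle on a core-free class. -/
theorem PureJunctions.rigidOK {l : V} (hl : l ∉ U) (hloop : ∀ e, ends e ≠ s(h, h))
    (ξ : Config E) : RigidOK ends l h o U ξ :=
  fun _ h𝓔 => rigidOK_of_coreFree hl hloop (fun _ hζ => hJ.coreFree hζ) h𝓔

/-- A region with pure junctions adjacent to `h` is a base region of the series reduction. -/
theorem PureJunctions.reducible {l : V} (hl : l ∉ U) (hloop : ∀ e, ends e ≠ s(h, h)) :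
    Reducible l h o ends U :=
  Reducible.base ends U fun ξ => hJ.rigidOK hl hloop ξ

end Sphere

section Rows

variable {l h o : V} {J : Set V}

/-- **Row 2′SW-ALL on every graph with pure junctions adjacent to `h`** in the region `{l}ᶜ`
(no loop at `h`). -/
theorem swAll_of_pureJunctions (hlh : l ≠ h) (hloop : ∀ e, ends e ≠ s(h, h))
    (hJ : PureJunctions ends ({l}ᶜ) h J o) : SwAll ends l h o :=
  swAll_of_reducible l h o hlh (hJ.reducible (by simp) hloop)

/-- **Row (SW) on every graph with pure junctions adjacent to `h`** (see
`swAll_of_pureJunctions`). -/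
theorem sw_of_pureJunctions (hlh : l ≠ h) (hloop : ∀ e, ends e ≠ s(h, h))
    (hJ : PureJunctions ends ({l}ᶜ) h J o) : Sw ends l h o :=
  sw_of_swAll ends (swAll_of_pureJunctions hlh hloop hJ)

variable {U : Set V} {u : V}

omit [Fintype E] [DecidableEq E] in
/-- **The single junction**: `u ∈ U ∖ {h, o}` joined to `h` by at most one edge, every other
neighbour `x ∈ U` of `u` in a component of `G[U ∖ {h, u}]` with no neighbour of `h`, every other
vertex of `U ∖ {h, o}` with an outside edge or no edge. -/
theorem pureJunctions_singleton (huU : u ∈ U) (huh : u ≠ h) (huo : u ≠ o)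
    (hunique : ∀ e e', ends e = s(h, u) → ends e' = s(h, u) → e = e')
    (hpure : ∀ e x, ends e = s(u, x) → x ∈ U → x ≠ h → x ≠ u →
      ∀ q ∈ compU ends U h u x, ∀ e', ends e' ≠ s(h, q))
    (hout : ∀ x ∈ U, x ≠ h → x ≠ o → x ≠ u →
      (∃ e y, ends e = s(x, y) ∧ y ∉ U) ∨ (∀ e, x ∉ ends e)) :
    PureJunctions ends U h {u} o where
  J_sub := by rintro _ rfl; exact huU
  J_ne_h := by rintro _ rfl; exact huh
  J_ne_o := by rintro _ rfl; exact huo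
  hu_unique := by rintro _ rfl; exact hunique
  no_JJ := by
    rintro _ rfl _ rfl hne
    exact absurd rfl hne
  pure := by
    rintro _ rfl e x hex hxU hxh hxu q hq
    rw [Set.mem_singleton_iff] at hxu
    refine ⟨hpure e x hex hxU hxh hxu q hq, ?_⟩
    rintro _ rfl hne
    exact absurd rfl hne
  hout := by
    intro x hxU hxh hxo hxu
    rw [Set.mem_singleton_iff] at hxu
    exact hout x hxU hxh hxo hxu

/-- **The rigid inequality on every class of a single pure junction adjacent to `h`.** -/
theorem rigidOK_of_pureJunction (hl : l ∉ U) (hloop : ∀ e, ends e ≠ s(h, h)) (huU : u ∈ U)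
    (huh : u ≠ h) (huo : u ≠ o)
    (hunique : ∀ e e', ends e = s(h, u) → ends e' = s(h, u) → e = e')
    (hpure : ∀ e x, ends e = s(u, x) → x ∈ U → x ≠ h → x ≠ u →
      ∀ q ∈ compU ends U h u x, ∀ e', ends e' ≠ s(h, q))
    (hout : ∀ x ∈ U, x ≠ h → x ≠ o → x ≠ u →
      (∃ e y, ends e = s(x, y) ∧ y ∉ U) ∨ (∀ e, x ∉ ends e)) (ξ : Config E) :
    RigidOK ends l h o U ξ :=
  (pureJunctions_singleton huU huh huo hunique hpure hout).rigidOK hl hloop ξ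

/-- **Row (SW) on every graph with one pure junction adjacent to `h`**: every vertex other
than `l, h, o, u` is joined to `l`, `u ≠ l, h, o`, `h` carries no loop, `u` is joined to `h` by
at most one edge and every other neighbour of `u` lies in a component of `G[{l}ᶜ ∖ {h, u}]` with
no neighbour of `h`. -/
theorem sw_of_pureJunction (hlh : l ≠ h) (hloop : ∀ e, ends e ≠ s(h, h)) (hul : u ≠ l)
    (huh : u ≠ h) (huo : u ≠ o)
    (hunique : ∀ e e', ends e = s(h, u) → ends e' = s(h, u) → e = e')
    (hpure : ∀ e x, ends e = s(u, x) → x ≠ l → x ≠ h → x ≠ u →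
      ∀ q ∈ compU ends ({l}ᶜ) h u x, ∀ e', ends e' ≠ s(h, q))
    (hjoin : ∀ x, x ≠ l → x ≠ h → x ≠ o → x ≠ u → ∃ e, ends e = s(x, l)) : Sw ends l h o := by
  refine sw_of_pureJunctions hlh hloop
    (pureJunctions_singleton (by simpa using hul) huh huo hunique ?_ ?_)
  · intro e x hex hxU hxh hxu
    exact hpure e x hex (by simpa using hxU) hxh hxu
  · intro x hx hxh hxo hxu
    obtain ⟨e, he⟩ := hjoin x (by simpa using hx) hxh hxo hxu
    exact Or.inl ⟨e, l, he, by simp⟩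

end Rows

end LocRows

end Summit.Ventures.PercRepro2
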